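import Summits.ValiantsHypothesis.ValiantsHypothesis.Theorems.DivisionGapPerDivisionHardWalkDefs
import Summits.ValiantsHypothesis.ValiantsHypothesis.Theorems.DivisionGapPerDivisionHardStubWalkBookkeepingTwin

/-!
# Crux `DivisionGap.PerDivisionHard` (stmt-ValiantsHypothesis-5065), line `pair-descent-jss-endpoint` —
stub `stub_walkTwin`: the reversal twin of a closed non-backtracking walk

Let `(rows, cols)` be a closed non-backtracking walk of length `L ≥ 2` based at the row `R₀`
(`IsClosedNBWalk`): the `t`-th row visit `rows t` is entered through the column `cols t` and left through
`cols (t+1)`, and `cols L = cols 0`.  Its TWIN `(rows', cols')` is the reversed walk re-based at the same row: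
`rows' 0 = rows 0`, `rows' t = rows (L - t)` (`1 ≤ t < L`), `cols' 0 = cols 1`, `cols' t = cols (L + 1 - t)`
(`1 ≤ t ≤ L`).  We prove (`stub_walkTwin`):

* the twin is again a closed non-backtracking walk based at `R₀` (every condition of the twin is a condition of
  the original walk read backwards; the twin's first/second row condition is the original CYCLIC condition and
  vice versa);
* the TWIN IDENTITY
  `walkExponent rows cols + Σ_t e_{(rows t, cols t)} = walkExponent rows' cols' + Σ_t e_{(rows t, cols (t+1))}`.

Proof of the identity.  The twin's visit `t` is the original visit `σ t` (`σ 0 = 0`, `σ t = L - t`, an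
involution of `Fin L`) with its in- and out-column SWAPPED (for `t = 0` this uses `cols L = cols 0`), so after
reindexing along `σ` (`Equiv.sum_comp`) the twin's exponent is `Σ_s walkStep (rows s) (cols (s+1)) (cols s)`.
Swapping in/out in a step exchanges the multiplicities `1 ↔ 2` on the two visit cells — which the two added cell
sums compensate (`e + e = 2e`, `Finsupp.single_add`) — and exchanges the two bookkeeping column sums
`Σ_{C ≠ Cᵢₙ} e_{(ρ₀,C)}`, `Σ_{C ≠ Cₒᵤₜ} 2e_{(ρ₀,C)}`; summed over the walk these only see the lists
`(cols 0, …, cols (L-1))` and `(cols 1, …, cols L)`, which agree as multisets because the walk is closed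
(`Fin.sum_univ_castSucc`, `Fin.sum_univ_succ` and cancellation in `(Fin n × Fin n) →₀ ℕ`).

References: dossier v8 §1 of the line; the bookkeeping invariance is `stub_walkBookkeepingTwin`
(`Theorems/DivisionGapPerDivisionHardStubWalkBookkeepingTwin.lean`), of which the shift argument here is the
special case actually needed.
-/

noncomputable section

-- `Summit.ValiantsHypothesis.ValiantsHypothesis.…` is the tree's mandated single-conjunct layout
-- (Sub = Summit), so the duplicated namespace component is intended.
set_option linter.dupNamespace false

namespace Summit.ValiantsHypothesis.ValiantsHypothesis.Theorems.DivisionGapPerDivisionHard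

open scoped BigOperators

/-- The twin reindexing of `Fin L` as a permutation: `σ = finRotate L ∘ Fin.rev` sends `0 ↦ 0` and
`t ↦ L - t` for `1 ≤ t < L` (the original visit that the `t`-th visit of the reversed, re-based walk repeats;
an involution). [folklore] -/
theorem exists_twinPerm (L : ℕ) :
    ∃ σ : Equiv.Perm (Fin L), ∀ t : Fin L, (σ t).val = if t.val = 0 then 0 else L - t.val := by
  refine ⟨Fin.revPerm.trans (finRotate L), fun t => ?_⟩
  obtain ⟨L, rfl⟩ : ∃ L', L = L' + 1 := ⟨L - 1, by have := t.pos; omega⟩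
  have ht := t.isLt
  rw [Equiv.trans_apply, Fin.revPerm_apply, coe_finRotate]
  by_cases h : t.val = 0
  · rw [if_pos h, if_pos (Fin.ext (by rw [Fin.val_rev, Fin.val_last]; omega))]
  · have hne : Fin.rev t ≠ Fin.last L := fun h' => h (by
      have := congrArg Fin.val h'
      rw [Fin.val_rev, Fin.val_last] at this
      omega)
    rw [if_neg h, if_neg hne, Fin.val_rev]
    omega

/-- Shift invariance along a closed column list: if `cols L = cols 0` then
`Σ_{s < L} G (cols s) = Σ_{s < L} G (cols (s+1))` in any right-cancellative additive commutative monoid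
(both sides complete to `Σ_{i ≤ L} G (cols i)` by the same term). [folklore] -/
theorem sum_closed_shift {α M : Type*} [AddCommMonoid M] [IsRightCancelAdd M] {L : ℕ}
    (cols : Fin (L + 1) → α) (hclosed : cols (Fin.last L) = cols 0) (G : α → M) :
    ∑ s : Fin L, G (cols s.castSucc) = ∑ s : Fin L, G (cols s.succ) := by
  have h1 := Fin.sum_univ_castSucc fun i => G (cols i)
  have h2 := Fin.sum_univ_succ fun i => G (cols i)
  rw [hclosed] at h1
  exact add_right_cancel (h1.symm.trans (h2.trans (add_comm _ _)))

/-- Bookkeeping for the swap identity: if `A = T + (U + V)` and `B = T + (U' + V')` pointwise with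
`Σ U = Σ U'` and `Σ V = Σ V'`, then `Σ A = Σ B`. [folklore] -/
theorem sum_eq_sum_of_parts {ι M : Type*} [Fintype ι] [AddCommMonoid M] (A B T U V U' V' : ι → M)
    (hA : ∀ s, A s = T s + (U s + V s)) (hB : ∀ s, B s = T s + (U' s + V' s))
    (hU : ∑ s, U s = ∑ s, U' s) (hV : ∑ s, V s = ∑ s, V' s) : ∑ s, A s = ∑ s, B s := by
  rw [Finset.sum_congr rfl fun s _ => hA s, Finset.sum_congr rfl fun s _ => hB s]
  simp only [Finset.sum_add_distrib, hU, hV]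

/-- **Swapping in- and out-columns of every step.**  If the in-column list and the out-column list of a family
of steps have the same sums against every `G` (e.g. they agree as multisets), then
`Σ_s walkStep (rows s) (cin s) (cout s) + Σ_s e_{(rows s, cin s)} =
 Σ_s walkStep (rows s) (cout s) (cin s) + Σ_s e_{(rows s, cout s)}`:
both sides equal `Σ_s [2e_{(rows s, cin s)} + 2e_{(rows s, cout s)} + Σ_{R' ≠ rows s} 3e_{(R',a₀)}]` plus the
two bookkeeping column sums, which are exchanged by the swap and have equal totals. [folklore] -/
theorem walkStep_swap_sum {ι : Type*} [Fintype ι] {n : ℕ} (ρ₀ a₀ : Fin n) (rows cin cout : ι → Fin n)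
    (hshift : ∀ G : Fin n → (Fin n × Fin n) →₀ ℕ, ∑ s, G (cin s) = ∑ s, G (cout s)) :
    ∑ s, walkStep ρ₀ a₀ (rows s) (cin s) (cout s) + ∑ s, Finsupp.single (rows s, cin s) 1 =
      ∑ s, walkStep ρ₀ a₀ (rows s) (cout s) (cin s) + ∑ s, Finsupp.single (rows s, cout s) 1 := by
  have h2 : ∀ p : Fin n × Fin n,
      (Finsupp.single p 1 + Finsupp.single p 1 : (Fin n × Fin n) →₀ ℕ) = Finsupp.single p 2 :=
    fun p => by rw [show (2 : ℕ) = 1 + 1 from rfl, Finsupp.single_add]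
  have hA : ∀ s, walkStep ρ₀ a₀ (rows s) (cin s) (cout s) + Finsupp.single (rows s, cin s) 1 =
      (Finsupp.single (rows s, cin s) 2 + Finsupp.single (rows s, cout s) 2 +
          ∑ R' ∈ Finset.univ.erase (rows s), Finsupp.single (R', a₀) 3) +
        (∑ C ∈ Finset.univ.erase (cin s), Finsupp.single (ρ₀, C) 1 +
          ∑ C ∈ Finset.univ.erase (cout s), Finsupp.single (ρ₀, C) 2) := by
    intro s
    rw [← h2 (rows s, cin s)]
    unfold walkStep
    abel
  have hB : ∀ s, walkStep ρ₀ a₀ (rows s) (cout s) (cin s) + Finsupp.single (rows s, cout s) 1 =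
      (Finsupp.single (rows s, cin s) 2 + Finsupp.single (rows s, cout s) 2 +
          ∑ R' ∈ Finset.univ.erase (rows s), Finsupp.single (R', a₀) 3) +
        (∑ C ∈ Finset.univ.erase (cout s), Finsupp.single (ρ₀, C) 1 +
          ∑ C ∈ Finset.univ.erase (cin s), Finsupp.single (ρ₀, C) 2) := by
    intro s
    rw [← h2 (rows s, cout s)]
    unfold walkStep
    abel
  rw [← Finset.sum_add_distrib, ← Finset.sum_add_distrib]
  exact sum_eq_sum_of_parts _ _ _ _ _ _ _ hA hB
    (hshift fun c => ∑ C ∈ Finset.univ.erase c, Finsupp.single (ρ₀, C) 1)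
    (hshift fun c => ∑ C ∈ Finset.univ.erase c, Finsupp.single (ρ₀, C) 2).symm

/-- **stub_walkTwin — the reversal twin.**  Let `(rows, cols)` be a closed non-backtracking walk of length
`L ≥ 2` based at `R₀`, and let `(rows', cols')` be its REVERSAL re-based at `R₀`: `rows' 0 = rows 0`,
`rows' t = rows (L - t)` for `1 ≤ t < L`, `cols' 0 = cols 1`, `cols' t = cols (L+1-t)` for `1 ≤ t ≤ L` (stated
index-free).  Then `(rows', cols')` is again a closed non-backtracking walk based at `R₀`, and the two exponents
satisfy the TWIN IDENTITY
`walkExponent rows cols + Σ_t e_{(rows t, cols t)} = walkExponent rows' cols' + Σ_t e_{(rows t, cols (t+1))}`: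
the reversal repeats the original visits along the involution `t ↦ L - t` (`0 ↦ 0`, `exists_twinPerm`) with the in- and out-column of every
visit swapped (multiplicities `1 ↔ 2` on the visit cells), and keeps the total bookkeeping because the in-column
list `cols 0, …, cols (L-1)` and the out-column list `cols 1, …, cols L` of a closed walk agree as multisets
(`walkStep_swap_sum`, `sum_closed_shift`).  So a closed walk and its twin agree off the visit cells and differ
there by the walk's net flow. [folklore] -/
theorem stub_walkTwin :
    ∀ (n L : ℕ) (R₀ ρ₀ a₀ : Fin n) (rows rows' : Fin L → Fin n) (cols cols' : Fin (L + 1) → Fin n),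
      2 ≤ L → IsClosedNBWalk L R₀ rows cols →
      (∀ t : Fin L, t.val = 0 → rows' t = rows t) →
      (∀ t t' : Fin L, t.val ≠ 0 → t.val + t'.val = L → rows' t = rows t') →
      (∀ t t₁ : Fin (L + 1), t.val = 0 → t₁.val = 1 → cols' t = cols t₁) →
      (∀ t t' : Fin (L + 1), t.val ≠ 0 → t.val + t'.val = L + 1 → cols' t = cols t') →
      IsClosedNBWalk L R₀ rows' cols' ∧
        walkExponent ρ₀ a₀ rows cols + ∑ t : Fin L, Finsupp.single (rows t, cols t.castSucc) 1 =
          walkExponent ρ₀ a₀ rows' cols' + ∑ t : Fin L, Finsupp.single (rows t, cols t.succ) 1 := by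
  intro n L R₀ ρ₀ a₀ rows rows' cols cols' hL hw hr0 hr hc0 hc
  obtain ⟨hbase, hclosed, hcolnb, hrownb, hcyc⟩ := hw
  -- the original walk conditions, stated for arbitrary indices
  have hcolnb' : ∀ i j : Fin (L + 1), j.val = i.val + 1 → cols i ≠ cols j := by
    rintro ⟨i, hi⟩ ⟨j, hj⟩ (hij : j = i + 1)
    subst hij
    exact hcolnb ⟨i, by omega⟩
  have hrownb' : ∀ i j : Fin L, j.val = i.val + 1 → rows i ≠ rows j := by
    rintro ⟨i, hi⟩ ⟨j, hj⟩ (hij : j = i + 1)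
    subst hij
    exact hrownb ⟨i, hi⟩ hj
  have hcyc' : ∀ i j : Fin L, i.val = L - 1 → j.val = 0 → rows i ≠ rows j := by
    rintro ⟨i, hi⟩ ⟨j, hj⟩ (h1 : i = L - 1) (h2 : j = 0)
    subst h1 h2
    exact hcyc (by omega)
  refine ⟨⟨?_, ?_, ?_, ?_, ?_⟩, ?_⟩
  · -- based at `R₀`
    intro h
    rw [hr0 _ rfl]
    exact hbase h
  · -- closed: `cols' L = cols 1 = cols' 0`
    rw [hc (Fin.last L) ⟨1, by omega⟩ (by rw [Fin.val_last]; omega) (by simp),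
      hc0 0 ⟨1, by omega⟩ (by simp) rfl]
  · -- consecutive columns of the twin differ
    intro t
    have htL := t.isLt
    by_cases ht : t.val = 0
    · rw [hc0 t.castSucc ⟨1, by omega⟩ (by simp only [Fin.val_castSucc]; exact ht) rfl,
        hc t.succ (Fin.last L) (by simp only [Fin.val_succ]; omega)
          (by simp only [Fin.val_succ, Fin.val_last]; omega), hclosed]
      exact (hcolnb' 0 ⟨1, by omega⟩ (by simp)).symm
    · rw [hc t.castSucc ⟨L + 1 - t.val, by omega⟩ (by simp only [Fin.val_castSucc]; exact ht)
          (by simp only [Fin.val_castSucc]; omega),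
        hc t.succ ⟨L - t.val, by omega⟩ (by simp only [Fin.val_succ]; omega)
          (by simp only [Fin.val_succ]; omega)]
      exact (hcolnb' ⟨L - t.val, by omega⟩ ⟨L + 1 - t.val, by omega⟩ (by show L + 1 - t.val = L - t.val + 1; omega)).symm
  · -- consecutive rows of the twin differ
    intro t h
    have htL := t.isLt
    by_cases ht : t.val = 0
    · rw [hr0 t ht, hr ⟨t.val + 1, h⟩ ⟨L - 1, by omega⟩ (by simp) (by show t.val + 1 + (L - 1) = L; omega)]
      exact (hcyc' ⟨L - 1, by omega⟩ t rfl ht).symm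
    · rw [hr t ⟨L - t.val, by omega⟩ ht (by show t.val + (L - t.val) = L; omega),
        hr ⟨t.val + 1, h⟩ ⟨L - t.val - 1, by omega⟩ (by simp)
          (by show t.val + 1 + (L - t.val - 1) = L; omega)]
      exact (hrownb' ⟨L - t.val - 1, by omega⟩ ⟨L - t.val, by omega⟩
        (by show L - t.val = L - t.val - 1 + 1; omega)).symm
  · -- the twin closes without backtracking
    intro h
    rw [hr ⟨L - 1, by omega⟩ ⟨1, by omega⟩ (by show L - 1 ≠ 0; omega) (by show L - 1 + 1 = L; omega),
      hr0 ⟨0, by omega⟩ rfl]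
    exact (hrownb' ⟨0, by omega⟩ ⟨1, by omega⟩ rfl).symm
  · -- the twin identity
    obtain ⟨σ, hσ⟩ := exists_twinPerm L
    have hσ0 : ∀ t : Fin L, t.val = 0 → (σ t).val = 0 := fun t h => by rw [hσ t, if_pos h]
    have hσ1 : ∀ t : Fin L, t.val ≠ 0 → (σ t).val = L - t.val := fun t h => by rw [hσ t, if_neg h]
    have F1 : ∀ t : Fin L, rows' t = rows (σ t) := by
      intro t
      have htL := t.isLt
      by_cases ht : t.val = 0
      · rw [hr0 t ht]
        exact congrArg rows (Fin.ext (by rw [hσ0 t ht]; exact ht))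
      · exact hr t _ ht (by rw [hσ1 t ht]; omega)
    have F2 : ∀ t : Fin L, cols' t.castSucc = cols (σ t).succ := by
      intro t
      have htL := t.isLt
      by_cases ht : t.val = 0
      · have h0 := hσ0 t ht
        exact hc0 _ _ (by simp only [Fin.val_castSucc]; exact ht) (by simp only [Fin.val_succ]; omega)
      · have h1 := hσ1 t ht
        exact hc _ _ (by simp only [Fin.val_castSucc]; exact ht)
          (by simp only [Fin.val_castSucc, Fin.val_succ]; omega)
    have F3 : ∀ t : Fin L, cols' t.succ = cols (σ t).castSucc := by
      intro t
      have htL := t.isLt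
      by_cases ht : t.val = 0
      · have h0 := hσ0 t ht
        rw [hc t.succ (Fin.last L) (by simp only [Fin.val_succ]; omega)
            (by simp only [Fin.val_succ, Fin.val_last]; omega), hclosed]
        exact congrArg cols (Fin.ext (by simp [h0]))
      · have h1 := hσ1 t ht
        exact hc _ _ (by simp only [Fin.val_succ]; omega)
          (by simp only [Fin.val_succ, Fin.val_castSucc]; omega)
    have hexp' : walkExponent ρ₀ a₀ rows' cols' =
        ∑ s : Fin L, walkStep ρ₀ a₀ (rows s) (cols s.succ) (cols s.castSucc) := by
      calc walkExponent ρ₀ a₀ rows' cols'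
          = ∑ t : Fin L, walkStep ρ₀ a₀ (rows (σ t)) (cols (σ t).succ) (cols (σ t).castSucc) := by
            unfold walkExponent
            exact Finset.sum_congr rfl fun t _ => by rw [F1 t, F2 t, F3 t]
        _ = ∑ s : Fin L, walkStep ρ₀ a₀ (rows s) (cols s.succ) (cols s.castSucc) :=
            Equiv.sum_comp σ (fun s => walkStep ρ₀ a₀ (rows s) (cols s.succ) (cols s.castSucc))
    have hshift : ∀ G : Fin n → (Fin n × Fin n) →₀ ℕ,
        ∑ s : Fin L, G (cols s.castSucc) = ∑ s : Fin L, G (cols s.succ) :=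
      fun G => sum_closed_shift cols hclosed G
    rw [hexp']
    unfold walkExponent
    exact walkStep_swap_sum ρ₀ a₀ rows (fun s => cols s.castSucc) (fun s => cols s.succ) hshift

end Summit.ValiantsHypothesis.ValiantsHypothesis.Theorems.DivisionGapPerDivisionHard

end
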